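import Literature.MathematicalPhysics.QuantumFieldTheory.Balaban1983to89.Node00.TkWeightsOfRecordP
import Literature.MathematicalPhysics.QuantumFieldTheory.Balaban1983to89.Node00.Record12MeasurabilityAbsolute

/-!
# DAG node N11 — MEASURABILITY THROUGH 11a's OPERATOR ALGEBRA (2.20)–(2.21): the kernel transport with parameters, the V-∕ζ-∕A-factors, one generation, the
# ordered product `𝐓_k`, the branch operator of record read at the base configuration; and the (3.16)∕(3.3)∕(3.21) weight factors of 12a∕12a″ — the GENERIC
# kernel half of this seat's displayed old-branch measurability binder `hmB` (p547524)

HEADER — WORK-UNIT METADATA.  Cell `pub-ymgap`, YM-PLAN Track A (HUMAN RULING D-0062), seat `pub-ymgap-dag-n11-d` (g9; R134 fan-out seat N11 [B14], strategy s2),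
route `BalabanUVNodes` rev 25, item K1⁷ `StabilityBAtRecordR13SepCoPH` = stmt-QuantumFields-20542 (helper, `--kind proof --supports 20542 --as helper`, count-neutral).
[III] = [Balaban1988Convergent].  Over node00-def-T's 11a `Node00/TkOfRecord.lean` (`kernelRT`, `vOp`, `aOp`, `zetaOp`, `genOp`, `tkOp`, `baseCfg`, `genDataOfRecord`,
`tkBranchOfRecord`), 12a∕12a″ (`chiSmallAW`, `chiLargeAW`, `chiPrimeW`, `chiAW`, `tkWeightsOfRecordP`), r11's `B14.Eq316.chiK∕chiKc`, `B14.Sect3Decomp.SmallApproxFluct`,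
the cell's `T4AveragingDisintegration` (`kernelTransport`, `margDensity`, `condLaw`), node00-def-K0c's (H-U) theorem `Record12MeasurabilityAbsolute.localBgMeasurable`, and
Mathlib's kernel-integral measurability (`StronglyMeasurable.integral_kernel_prod_right'`, `StronglyMeasurable.integral_prod_right'`, `measurable_update'`,
`measurable_updateFinset'`).

WHY THIS FILE (this seat's g7∕g8 located dead end «hmB: measurable selection ∕ kernel measurability», re-examined).  The general-history no-expansion 𝐓-step
(p544575 ∕ p547524) and every diagonal theorem built on it (this seat's door file p547792, dag-n11-e's diagonal induction p536887 ∕ p549594) display the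
MEASURABILITY of the old branch `U₀ ↦ 𝐓_k(init s′, S)[e^{A_k(init s′)}](U₀)` as a hypothesis (`hmB`), «the restricted-averaging kernel has no measurability lemma in
the tree».  This file supplies that lemma GENERICALLY: 11a's kernel restricted transport is jointly measurable in (parameter, coarse variables) for jointly
measurable integrands (§1–§2), so every generation and the ordered product preserve measurability when the weights are measurable (§2–§3), and 12a's weight
factors ARE measurable (§4; the (3.3) factor through def-R's one-cube background, measurable by K0c's (H-U) theorem).  What a consumer must still supply is the
measurability of the RESIDUAL's `ζ0_j(Y)`, `quad_j(Λ′)` and of the OPERAND — both available along the all-large-field diagonal (sequel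
`…N11DiagonalOldBranchMeasurable`: `hmB` discharged there).  The BOUND binder `hCB` is NOT touched: it runs through a sup bound on `margDensity`, which the tree has
only as absolute continuity (located; wants re-typing to joint integrability).

WHAT THIS FILE PROVES (0 `sorry`, 0 `def`, standard axioms).  §1 `measurable_kernelTransport_param`, `measurable_kernelTransport` · §2 `measurable_kernelRT_param`,
`measurable_vOp_kernelRT`, `measurable_aOp`, `measurable_zetaOp`, `measurable_genOp_kernelRT`, `measurable_tkOp`, `measurable_baseCfg` · §3 `measurable_genOp_genDataOfRecord`,
★ `measurable_tkBranchOfRecord_baseCfg` (the SHAPE of `hmB`, for every weight datum with measurable `ζ_j(Y)`, `w_j(Λ′,Y,S)` and every measurable operand),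
`measurable_w_of_chiA_quad` · §4 `measurableSet_smallFluct`, `measurable_chiK316`, `measurable_chiKc316`, ★ `measurableSet_smallApproxFluctW`, `measurable_chiPrimeW`,
`measurable_chiSmallAW`, `measurable_chiLargeAW`, ★ `measurable_chiAW`, `measurable_tkWeightsOfRecordP_ζ`, `measurable_tkWeightsOfRecordP_w`.

HONEST FRAMING.  Count-neutral [folklore] measure theory over the tree's own objects; nothing of Bałaban's asserted; no binder of any accepted theorem is changed here
(consumers cite these lemmas to inhabit `hmB`); N11 NOT discharged; K1⁷ NOT closed; counts unmoved (typed 28∕28 · discharged 5∕28).  One finite four-torus programme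
at fixed `ε = L^{−K}` — NOT ℝ⁴, NOT OS, NOT a mass gap, NOT Clay.  The 11a generic lemmas take the `DecidableEq (PBond …)` instance as an IMPLICIT binder (11a's
branch operator carries the classical one).
Sources (SHAPE only): [III] (2.18) p.257, (2.20)–(2.21) p.258, (3.3)–(3.4) p.265, (3.16) p.268, (3.21) p.269, (3.23)–(3.24) p.270, (2.16) p.257; [Balaban1985Averaging] (10) p.19.
-/

noncomputable section

open MeasureTheory ProbabilityTheory
open scoped BigOperators Matrix.Norms.L2Operator

namespace Summit.QuantumFields.YangMills.Theorems.BalabanUVNodesN11TkOpMeasurable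

open Literature.MathematicalPhysics.QuantumFieldTheory.Balaban1983to89 T4Continuum T4NestedCovariance T4AdjointCovariance
open T4AveragingDisintegration (kernelTransport margDensity condLaw measurable_margDensity)
open Node00 Node00.Tk B14.Eq316 B14.Sect3Decomp

universe u

/-! ## §1  The kernel transport is jointly measurable in (parameter, coarse variable) -/

section Kernel

variable {γ α β : Type*} [MeasurableSpace γ] [MeasurableSpace α] [MeasurableSpace β] [StandardBorelSpace β] [Nonempty β]

/-- **THE KERNEL TRANSPORT OF A JOINTLY MEASURABLE INTEGRAND FAMILY IS JOINTLY MEASURABLE** in the family parameter and the coarse variable: `(c, a) ↦ h(a)·∫ f(c, b) κ(a, db)`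
(`margDensity` is measurable; the conditional-law integral of a jointly measurable integrand is measurable by Mathlib's `StronglyMeasurable.integral_kernel_prod_right'`
applied to the kernel `Kernel.prodMkLeft γ condLaw`). [cite: Balaban1985Averaging, (10) p.19 (bookkeeping)] -/
theorem measurable_kernelTransport_param (ν : Measure β) [IsFiniteMeasure ν] (μ : Measure α) (avg : β → α)
    {f : γ × β → ℝ} (hf : Measurable f) :
    Measurable (fun z : γ × α => kernelTransport ν μ avg (fun b => f (z.1, b)) z.2) := by
  unfold kernelTransport
  have h1 : Measurable fun z : γ × α => (margDensity ν μ avg z.2 : ℝ) :=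
    (measurable_margDensity.comp measurable_snd).coe_nnreal_real
  have h2 : StronglyMeasurable fun z : γ × α => ∫ b, f (z.1, b) ∂(condLaw ν avg z.2) := by
    have hg : StronglyMeasurable (fun w : (γ × α) × β => f (w.1.1, w.2)) :=
      (hf.comp (measurable_fst.fst.prodMk measurable_snd)).stronglyMeasurable
    have := hg.integral_kernel_prod_right' (κ := Kernel.prodMkLeft γ (condLaw ν avg))
    simpa [Kernel.prodMkLeft_apply] using this
  exact h1.mul h2.measurable

/-- … in particular the transport of ONE measurable integrand is a measurable function of the coarse variable. [cite: Balaban1985Averaging, (10) p.19 (bookkeeping)] -/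
theorem measurable_kernelTransport (ν : Measure β) [IsFiniteMeasure ν] (μ : Measure α) (avg : β → α) {ρ : β → ℝ} (hρ : Measurable ρ) :
    Measurable (kernelTransport ν μ avg ρ) := by
  have h := measurable_kernelTransport_param (γ := Unit) ν μ avg (f := fun z : Unit × β => ρ z.2) (hρ.comp measurable_snd)
  have hι : Measurable fun a : α => ((), a) := (measurable_const : Measurable fun _ : α => ()).prodMk measurable_id
  exact h.comp hι

end Kernel

/-! ## §2  11a's operator algebra preserves measurability -/

section Operators

variable {P : Params} {G : Type u} {V : Type u} [MeasurableSpace G] [MeasurableSpace V]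

/-- **11a's KERNEL RESTRICTED TRANSPORT IS JOINTLY MEASURABLE** in (parameter, coarse bond variables) for a jointly measurable integrand family.
[cite: Balaban1988Convergent, (2.21) p.258 (bookkeeping)] -/
theorem measurable_kernelRT_param [GaugeGroup G] [HaarData G] [StandardBorelSpace G] {γ : Type*} [MeasurableSpace γ] {ι ι' : Type*} [Fintype ι] [Fintype ι']
    (avg : (ι → G) → (ι' → G))
    {f : γ × (ι → G) → ℝ} (hf : Measurable f) :
    Measurable (fun z : γ × (ι' → G) => kernelRT avg (fun y => f (z.1, y)) z.2) := by
  haveI : Nonempty (ι → G) := ⟨fun _ => 1⟩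
  unfold kernelRT
  exact measurable_kernelTransport_param _ _ avg hf

/-- **THE V-FACTOR `vOp` OVER THE KERNEL TRANSPORT PRESERVES MEASURABILITY** (the operand is read at the all-scales configuration updated at scale `j` by the
integrated bond variables — a jointly measurable insertion (`measurable_update'`, `measurable_updateFinset'`) — and the transport is read at the scale-`(j+1)` bond
variables). [cite: Balaban1988Convergent, (2.21) p.258 (bookkeeping)] -/
theorem measurable_vOp_kernelRT [GaugeGroup G] [HaarData G] [StandardBorelSpace G] (j : ℕ) {hdec : DecidableEq (PBond P j)} (sV : Finset (PBond P j))
    (sV' : Finset (PBond P (j + 1))) (avg : (↥sV → G) → (↥sV' → G)) {F : MultiCfg P G V → ℝ} (hF : Measurable F) :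
    Measurable (vOp j sV sV' (kernelRT avg) F) := by
  have hj : Measurable (fun z : MultiCfg P G V × (↥sV → G) => z.1 j) := (measurable_pi_apply j).comp measurable_fst
  have hins : Measurable (fun z : MultiCfg P G V × (↥sV → G) =>
      Function.update z.1 j (Function.updateFinset (z.1 j).1 sV z.2, (z.1 j).2)) :=
    measurable_update'.comp (measurable_fst.prodMk
      ((measurable_updateFinset'.comp ((measurable_fst.comp hj).prodMk measurable_snd)).prodMk (measurable_snd.comp hj)))
  have hf : Measurable (fun z : MultiCfg P G V × (↥sV → G) =>
      F (Function.update z.1 j (Function.updateFinset (z.1 j).1 sV z.2, (z.1 j).2))) := hF.comp hins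
  have hout : Measurable (fun ω : MultiCfg P G V => (ω, fun b : ↥sV' => (ω (j + 1)).1 (b : PBond P (j + 1)))) :=
    measurable_id.prodMk (measurable_pi_lambda _ fun b =>
      (measurable_pi_apply (b : PBond P (j + 1))).comp (measurable_fst.comp (measurable_pi_apply (j + 1))))
  exact (measurable_kernelRT_param avg hf).comp hout

/-- **THE A-FACTOR `aOp` PRESERVES MEASURABILITY** for a measurable weight (the Lebesgue integral over the fluctuation variables on `sA` of a jointly measurable
integrand; Mathlib's `StronglyMeasurable.integral_prod_right'`). [cite: Balaban1988Convergent, (2.21) p.258 (bookkeeping)] -/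
theorem measurable_aOp [NormedAddCommGroup V] [InnerProductSpace ℝ V] [FiniteDimensional ℝ V] [BorelSpace V] (j : ℕ) {hdec : DecidableEq (PBond P j)}
    (sA : Finset (PBond P j)) {w F : MultiCfg P G V → ℝ} (hw : Measurable w) (hF : Measurable F) : Measurable (aOp j sA w F) := by
  have hj : Measurable (fun z : MultiCfg P G V × (↥sA → V) => z.1 j) := (measurable_pi_apply j).comp measurable_fst
  have hins : Measurable (fun z : MultiCfg P G V × (↥sA → V) => Function.update z.1 j (insA sA z.2 (z.1 j))) :=
    measurable_update'.comp (measurable_fst.prodMk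
      ((measurable_fst.comp hj).prodMk (measurable_updateFinset'.comp ((measurable_snd.comp hj).prodMk measurable_snd))))
  have hf : Measurable (fun z : MultiCfg P G V × (↥sA → V) =>
      w (Function.update z.1 j (insA sA z.2 (z.1 j))) * F (Function.update z.1 j (insA sA z.2 (z.1 j)))) :=
    (hw.comp hins).mul (hF.comp hins)
  exact (hf.stronglyMeasurable.integral_prod_right' (ν := Measure.pi fun _ : ↥sA => (volume : Measure V))).measurable

/-- **THE ζ-WEIGHT `zetaOp` PRESERVES MEASURABILITY** (a product). [cite: Balaban1988Convergent, (2.21) p.258 (bookkeeping)] -/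
theorem measurable_zetaOp {ζ F : MultiCfg P G V → ℝ} (hζ : Measurable ζ) (hF : Measurable F) : Measurable (zetaOp ζ F) :=
  hζ.mul hF

/-- **ONE GENERATION 𝐓^{(j)} OVER THE KERNEL TRANSPORT PRESERVES MEASURABILITY** for measurable `ζ`- and A-weights. [cite: Balaban1988Convergent, (2.21) p.258 (bookkeeping)] -/
theorem measurable_genOp_kernelRT [GaugeGroup G] [HaarData G] [StandardBorelSpace G] [NormedAddCommGroup V] [InnerProductSpace ℝ V] [FiniteDimensional ℝ V]
    [BorelSpace V] (j : ℕ) {hdec : DecidableEq (PBond P j)} (sV : Finset (PBond P j)) (sV' : Finset (PBond P (j + 1)))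
    (avg : (↥sV → G) → (↥sV' → G)) {ζ : MultiCfg P G V → ℝ} (sA : Finset (PBond P j)) {w : MultiCfg P G V → ℝ}
    (hζ : Measurable ζ) (hw : Measurable w) {F : MultiCfg P G V → ℝ} (hF : Measurable F) :
    Measurable (genOp j ⟨sV, sV', kernelRT avg, ζ, sA, w⟩ F) :=
  measurable_vOp_kernelRT j sV sV' avg (measurable_zetaOp hζ (measurable_aOp j sA hw hF))

/-- **THE ORDERED PRODUCT (2.20) PRESERVES MEASURABILITY** when every generation does. [cite: Balaban1988Convergent, (2.20) p.258 (bookkeeping)] -/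
theorem measurable_tkOp (gen : ℕ → Op (MultiCfg P G V) ℝ) (hgen : ∀ j (F : MultiCfg P G V → ℝ), Measurable F → Measurable (gen j F))
    (k : ℕ) {F : MultiCfg P G V → ℝ} (hF : Measurable F) : Measurable (tkOp gen k F) := by
  induction k with
  | zero => exact hF
  | succ k ih => exact hgen k _ ih

/-- **11a's BASE CONFIGURATION IS MEASURABLE in the scale-`k` field** (`V_k` at scale `k`, constants elsewhere). [cite: Balaban1988Convergent, (2.18) p.257 (bookkeeping)] -/
theorem measurable_baseCfg [One G] [Zero V] (k : ℕ) : Measurable (baseCfg (P := P) (G := G) (V := V) k) := by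
  refine measurable_pi_lambda _ fun j => ?_
  refine Measurable.prodMk (measurable_pi_lambda _ fun b => ?_) measurable_const
  by_cases hj : j = k
  · simp only [dif_pos hj]
    exact measurable_pi_apply (X := fun _ : PBond P k => G) (hj ▸ b)
  · simp only [dif_neg hj]
    exact measurable_const

end Operators

/-! ## §3  The branch operator of record read at the base configuration is measurable (measurable weights, measurable operand) -/

section Branch

variable (F : T4Family) (N : ℕ) [NeZero N] (V : Type) [NormedAddCommGroup V] [InnerProductSpace ℝ V] [FiniteDimensional ℝ V]
  [MeasurableSpace V] [BorelSpace V]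
variable (ν : Stage7Numerics) (M : ℕ) (g : ℕ → ℝ) (K : ℕ)

/-- **ONE GENERATION OF RECORD PRESERVES MEASURABILITY** for a weight datum with measurable `ζ_j(Y)` and `w_j(Λ′, Y, S)` at the regions the generation reads.
[cite: Balaban1988Convergent, (2.21) p.258, (3.23) p.270 (bookkeeping)] -/
theorem measurable_genOp_genDataOfRecord (W : TkWeights F N V K) {n : ℕ} (s : SeqOfRecord F ν M g K n) (S : ℕ → Set (Site (F.P K) 0)) (j : ℕ)
    {hdec : DecidableEq (PBond (F.P K) j)}
    (hζ : Measurable (W.ζ j (s.Ω (j + 1))ᶜ)) (hw : Measurable (W.w j (s.Λ (j + 1)) ((s.Λ (j + 1))ᶜ ∩ s.Ω (j + 1)) (S (j + 1))))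
    {Φ : MultiCfg (F.P K) (SU N) V → ℝ} (hΦ : Measurable Φ) :
    Measurable (genOp j (genDataOfRecord F N V ν M g K W s S j) Φ) :=
  measurable_genOp_kernelRT j _ _ _ _ hζ hw hΦ

/-- **★ THE BRANCH OPERATOR OF RECORD READ AT THE BASE CONFIGURATION IS MEASURABLE IN THE SCALE-`k` FIELD** — the shape of this seat's displayed old-branch binder `hmB`
(p547524) — for every weight datum whose `ζ_j(Y)` and `w_j(Λ′, Y, S)` are measurable functions of the all-scales configuration and every measurable operand.
[cite: Balaban1988Convergent, (2.18) p.257, (2.20)–(2.21) p.258, (3.24) p.270 (bookkeeping)] -/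
theorem measurable_tkBranchOfRecord_baseCfg (W : TkWeights F N V K) (hζ : ∀ j Y, Measurable (W.ζ j Y)) (hw : ∀ j Λ' Y S, Measurable (W.w j Λ' Y S))
    {n : ℕ} (s : SeqOfRecord F ν M g K n) (S : ℕ → Set (Site (F.P K) 0)) (k : ℕ) {Φ : MultiCfg (F.P K) (SU N) V → ℝ} (hΦ : Measurable Φ) :
    Measurable fun U₀ : GaugeField (F.P K) k (SU N) => tkBranchOfRecord F N V ν M g K W s S k Φ (baseCfg k U₀) := by
  have h : Measurable (tkBranchOfRecord F N V ν M g K W s S k Φ) := by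
    unfold tkBranchOfRecord
    exact measurable_tkOp _ (fun j Ψ hΨ => measurable_genOp_genDataOfRecord F N V ν M g K W s S j (hζ j _) (hw j _ _ _) hΨ) k hΦ
  exact h.comp (measurable_baseCfg k)

omit [NeZero N] [NormedAddCommGroup V] [InnerProductSpace ℝ V] [FiniteDimensional ℝ V] [BorelSpace V] in
/-- **THE A-WEIGHTS `w_j = χA_j · e^{−quad_j∕2}` OF A WEIGHT DATUM ARE MEASURABLE** when `χA_j` and `quad_j` are. [cite: Balaban1988Convergent, (2.21) p.258, (3.23) p.270 (bookkeeping)] -/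
theorem measurable_w_of_chiA_quad (W : TkWeights F N V K) (j : ℕ) (Λ' Y S : Set (Site (F.P K) 0)) (hχ : Measurable (W.chiA j Y S))
    (hq : Measurable (W.quad j Λ')) : Measurable (W.w j Λ' Y S) :=
  hχ.mul (Real.measurable_exp.comp (measurable_const.mul hq))

end Branch

/-! ## §4  The (3.16)∕(3.3)∕(3.21) weight factors of 12a are measurable -/

section ChiFactors

variable {ι β 𝔸 : Type*} [Fintype β] [SeminormedAddCommGroup 𝔸] [MeasurableSpace 𝔸] [OpensMeasurableSpace 𝔸]

/-- The small-fluctuation event `{sup_{b ∈ bonds □′} ‖A(b)‖ < δ}` of (3.16) is a measurable set of fluctuation fields. [cite: Balaban1988Convergent, (3.16) p.268 (bookkeeping)] -/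
theorem measurableSet_smallFluct (bonds : ι → Finset β) (δ : ℝ) (c : ι) :
    MeasurableSet {A : β → 𝔸 | SmallFluct bonds A δ c} := by
  have : {A : β → 𝔸 | SmallFluct bonds A δ c} = ⋂ b ∈ bonds c, {A : β → 𝔸 | ‖A b‖ < δ} := by
    ext A; simp [SmallFluct]
  rw [this]
  exact MeasurableSet.biInter (Set.to_countable _) fun b _ =>
    measurableSet_lt (continuous_norm.measurable.comp (measurable_pi_apply b)) measurable_const

/-- **r11's `χ^{(k)}(X)` (3.16) IS MEASURABLE in the fluctuation field.** [cite: Balaban1988Convergent, (3.16) p.268 (bookkeeping)] -/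
theorem measurable_chiK316 (bonds : ι → Finset β) (δ : ℝ) (X : Finset ι) :
    Measurable fun A : β → 𝔸 => chiK bonds A δ X := by
  classical
  unfold chiK
  refine Finset.measurable_prod X fun c _ => ?_
  exact Measurable.ite (measurableSet_smallFluct bonds δ c) measurable_const measurable_const

/-- **r11's `χ^{(k)c}(X)` (3.16) IS MEASURABLE in the fluctuation field.** [cite: Balaban1988Convergent, (3.16) p.268 (bookkeeping)] -/
theorem measurable_chiKc316 (bonds : ι → Finset β) (δ : ℝ) (X : Finset ι) :
    Measurable fun A : β → 𝔸 => chiKc bonds A δ X := by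
  classical
  unfold chiKc
  refine Finset.measurable_prod X fun c _ => ?_
  exact Measurable.ite (measurableSet_smallFluct bonds δ c) measurable_const measurable_const

variable (F : T4Family) (N : ℕ) [NeZero N] (V : Type) [MeasurableSpace V]
variable (ν : Stage7Numerics) (A₁ : ℝ) (p : B12.RunParams) (g : ℕ → ℝ) (j : ℕ)

/-- **THE (3.3) EVENT OF ONE χ_{j+1}-CUBE IS JOINTLY MEASURABLE in `(V_j, V_{j+1})`**: `sup_{b ∈ (□′^{∼2})^{(j)*}} |V_j(b)(M^j(U_{j+1,□′}(V_{j+1}))(b))⁻¹ − 1| < 2δ_j`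
— def-R's (2.16) one-cube background `U_{j+1,□′}` is measurable by node00-def-K0c's (H-U) theorem `localBgMeasurable`, the iterated averaging of record is measurable,
`|· − 1|`, products and inverses are measurable on `SU(N)`. [cite: Balaban1988Convergent, (3.3)–(3.4) p.265, (2.16) p.257 (bookkeeping)] -/
theorem measurableSet_smallApproxFluctW (c : Iχ F ν p g j) :
    MeasurableSet {z : GaugeField (F.P p.K) j (SU N) × GaugeField (F.P p.K) (j + 1) (SU N) |
      SmallApproxFluct (sect3DataW F N ν p g j) (avOfRecord F N p.K) (2 * deltaOfRecord ν g j A₁) z.1 z.2 c} := by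
  have hU : Measurable ((sect3DataW F N ν p g j).UkLoc c) := by
    show Measurable (ukLocW F N ν p g j c)
    exact localBgMeasurable F N ν p.K (j + 1) _
  have hV : Measurable fun V' : GaugeField (F.P p.K) (j + 1) (SU N) => Vbox (sect3DataW F N ν p g j) (avOfRecord F N p.K) c V' :=
    (measurable_iter (avOfRecord F N p.K) (avOfRecord_measurable F N p.K) j).comp hU
  have : {z : GaugeField (F.P p.K) j (SU N) × GaugeField (F.P p.K) (j + 1) (SU N) |
      SmallApproxFluct (sect3DataW F N ν p g j) (avOfRecord F N p.K) (2 * deltaOfRecord ν g j A₁) z.1 z.2 c} =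
      ⋂ b ∈ (sect3DataW F N ν p g j).bondsStar c, {z | dist1 (z.1 b * (Vbox (sect3DataW F N ν p g j) (avOfRecord F N p.K) c z.2 b)⁻¹) <
        2 * deltaOfRecord ν g j A₁} := by
    ext z; simp [SmallApproxFluct]
  rw [this]
  refine MeasurableSet.biInter (Set.to_countable _) fun b _ => measurableSet_lt ?_ measurable_const
  have h1 : Measurable fun z : GaugeField (F.P p.K) j (SU N) × GaugeField (F.P p.K) (j + 1) (SU N) => z.1 b :=
    (measurable_pi_apply b).comp measurable_fst
  have h2 : Measurable fun z : GaugeField (F.P p.K) j (SU N) × GaugeField (F.P p.K) (j + 1) (SU N) =>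
      (Vbox (sect3DataW F N ν p g j) (avOfRecord F N p.K) c z.2 b)⁻¹ :=
    ((measurable_pi_apply b).comp (hV.comp measurable_snd)).inv
  exact RegularGaugeGroup.measurable_dist1.comp (h1.mul h2)

/-- **12a's `χ′_j(X)` (3.3) IS MEASURABLE on the all-scales configuration** (it reads `((ω j).1, (ω (j+1)).1)`). [cite: Balaban1988Convergent, (3.3) p.265, (3.21) p.269 (bookkeeping)] -/
theorem measurable_chiPrimeW (X : Finset (Iχ F ν p g j)) : Measurable (chiPrimeW F N V ν A₁ p g j X) := by
  classical
  have hproj : Measurable fun ω : MultiCfg (F.P p.K) (SU N) V => ((ω j).1, (ω (j + 1)).1) :=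
    (measurable_fst.comp (measurable_pi_apply j)).prodMk (measurable_fst.comp (measurable_pi_apply (j + 1)))
  have heq : chiPrimeW F N V ν A₁ p g j X = fun ω =>
      if ∀ c ∈ X, SmallApproxFluct (sect3DataW F N ν p g j) (avOfRecord F N p.K) (2 * deltaOfRecord ν g j A₁) (ω j).1 (ω (j + 1)).1 c
      then (1 : ℝ) else 0 := funext fun ω => chiPrimeW_eq_ite X ω
  rw [heq]
  refine Measurable.ite ?_ measurable_const measurable_const
  have hset : {ω : MultiCfg (F.P p.K) (SU N) V | ∀ c ∈ X, SmallApproxFluct (sect3DataW F N ν p g j) (avOfRecord F N p.K)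
      (2 * deltaOfRecord ν g j A₁) (ω j).1 (ω (j + 1)).1 c} =
      ⋂ c ∈ X, (fun ω : MultiCfg (F.P p.K) (SU N) V => ((ω j).1, (ω (j + 1)).1)) ⁻¹'
        {z : GaugeField (F.P p.K) j (SU N) × GaugeField (F.P p.K) (j + 1) (SU N) |
          SmallApproxFluct (sect3DataW F N ν p g j) (avOfRecord F N p.K) (2 * deltaOfRecord ν g j A₁) z.1 z.2 c} := by
    ext ω; simp
  rw [hset]
  exact MeasurableSet.biInter (Set.to_countable _) fun c _ => hproj (measurableSet_smallApproxFluctW F N ν A₁ p g j c)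

omit [NeZero N] in
/-- **12a's `χ^{(j)}(X)` IS MEASURABLE on the all-scales configuration** (it reads `(ω j).2`). [cite: Balaban1988Convergent, (3.16) p.268 (bookkeeping)] -/
theorem measurable_chiSmallAW [SeminormedAddCommGroup V] [BorelSpace V] (X : Finset (Iχ F ν p g j)) : Measurable (chiSmallAW F N V ν A₁ p g j X) := by
  have hA : Measurable fun ω : MultiCfg (F.P p.K) (SU N) V => (ω j).2 := measurable_snd.comp (measurable_pi_apply j)
  have h := (measurable_chiK316 (𝔸 := V) (bondsStarW F ν p g j) (deltaOfRecord ν g j A₁) X).comp hA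
  exact h

omit [NeZero N] in
/-- **12a's `χ^{(j)c}(X)` IS MEASURABLE on the all-scales configuration.** [cite: Balaban1988Convergent, (3.16) p.268 (bookkeeping)] -/
theorem measurable_chiLargeAW [SeminormedAddCommGroup V] [BorelSpace V] (X : Finset (Iχ F ν p g j)) : Measurable (chiLargeAW F N V ν A₁ p g j X) := by
  have hA : Measurable fun ω : MultiCfg (F.P p.K) (SU N) V => (ω j).2 := measurable_snd.comp (measurable_pi_apply j)
  have h := (measurable_chiKc316 (𝔸 := V) (bondsStarW F ν p g j) (deltaOfRecord ν g j A₁) X).comp hA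
  exact h

/-- **★ 12a's (3.21) A-SIDE FACTOR `χA_j(Y, S)` IS MEASURABLE on the all-scales configuration** (product of the three factors above and a constant).
[cite: Balaban1988Convergent, (3.21) p.269, (3.16) p.268, (3.3) p.265 (bookkeeping)] -/
theorem measurable_chiAW [SeminormedAddCommGroup V] [BorelSpace V] (Y S : Set (Site (F.P p.K) 0)) : Measurable (chiAW F N V ν A₁ p g j Y S) := by
  classical
  unfold chiAW
  exact ((measurable_const.mul (measurable_chiSmallAW F N V ν A₁ p g j _)).mul (measurable_chiLargeAW F N V ν A₁ p g j _)).mul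
    (measurable_chiPrimeW F N V ν A₁ p g j _)

/-- **★ THE WEIGHTS OF 12a″'s DATUM `tkWeightsOfRecordP Z` ARE MEASURABLE** as soon as the residual's `ζ0_j(Y)` and `quad_j(Λ′)` are: `ζ_j(Y) = ζ0_j(Y)` and
`w_j(Λ′, Y, S) = χA_j(Y, S)·e^{−quad_j(Λ′)∕2}`. [cite: Balaban1988Convergent, (2.21) p.258, (3.21) p.269, (3.23) p.270 (bookkeeping)] -/
theorem measurable_tkWeightsOfRecordP_ζ [SeminormedAddCommGroup V] (Z : TkResidualW F N V p.K) (j : ℕ) (Y : Set (Site (F.P p.K) 0)) (hζ : Measurable (Z.ζ0 j Y)) :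
    Measurable ((tkWeightsOfRecordP F N V ν A₁ p g Z).ζ j Y) :=
  hζ

/-- (the A-weight half) [cite: Balaban1988Convergent, (2.21) p.258, (3.21) p.269, (3.23) p.270 (bookkeeping)] -/
theorem measurable_tkWeightsOfRecordP_w [SeminormedAddCommGroup V] [BorelSpace V] (Z : TkResidualW F N V p.K) (j : ℕ) (Λ' Y S : Set (Site (F.P p.K) 0)) (hq : Measurable (Z.quad j Λ')) :
    Measurable ((tkWeightsOfRecordP F N V ν A₁ p g Z).w j Λ' Y S) :=
  (measurable_chiAW F N V ν A₁ p g j Y S).mul (Real.measurable_exp.comp (measurable_const.mul hq))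

end ChiFactors

end Summit.QuantumFields.YangMills.Theorems.BalabanUVNodesN11TkOpMeasurable

end
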